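/-
Copyright (c) 2026 the pub-hodgecm-mathlib formalisation cell (harness21).  Prover seat hodgecm-mathlib-K2Liu-p05 (g9), R90-TF SLAB section S4 «Ch13.1–2»
(base R90-C131; L1 hand placed by chair VALVE 21 (x) as S4 second box + one payer), h413 = `stmt-HodgeConjecture-24833`; CARD F of the (DICT-Σ)
assembly (S4 dealer K2E2-plan (g8), R90 bus 2026-09-05T02:33:08Z S4-R43 (1) + 02:40:41Z S4-R47 (2)).
-/
import Summits.HodgeConjecture.HodgeConjecture.Theorems.R90S4CubicCartanStableClass   -- ★ p863813 (K2E3-p27): the CONSUMER `isConj_of_isStablyConjGAt_of_isField_cartanAlgebra … (hfield : IsField ↥(cartanAlgebra γ))`; brings ★ `cartanAlgebra`, `Gqs`, `LocalRing.isField_of_smul_eq`, ★ `commute_of_commute_of_isRegularElt_local`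
import Literature.LinearAlgebra.Matrix.NonderogatoryCommutant                        -- ★ `exists_eq_aeval_of_commute_of_minpoly_eq_charpoly` (Horn–Johnson Thm. 3.2.4.2: the commutant of a non-derogatory matrix is `K[γ]`)
import HarnessLib

/-!
# R90-TF · S4 — (DICT-Σ) CARD F `R90S4CubicCartanFieldBridge`: an element of `U(Φ₃)(L⁺_v)` with IRREDUCIBLE characteristic polynomial has a FIELD as Cartan
# algebra (type (3) of Rogawski 1990, §3.6: `T = Z_G(γ) ≅ K₃¹`), and the Cartan algebra is the same at every regular element of the torus

Cell `hodgecm-mathlib`, crux H413 = `stmt-HodgeConjecture-24833`, route of record `HCCMUnconditional`; R90-TF section S4 (Rogawski Ch. 13.1–2, base `R90-C131`),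
S4 dealer K2E2-plan (g8), hand K2Liu-p05 (g9).  This file supplies the two CLOSURES that the (DICT-Σ) assembly's type-(3) row needs (R90-C131-p01 (g2)'s assembly
census `48f38ffd809bd44d`, gaps (a)(a′)): the type-(3) members of the Cartan system arrive from ★ CARD D `R90S4RegularCharpolyTypeSplit` §2 BY CHARACTERISTIC
POLYNOMIAL («`χ_γ` irreducible cubic»), while the type-(3) dictionary ★ `R90S4CubicCartanStableClass.isConj_of_isStablyConjGAt_of_isField_cartanAlgebra` eats the
letter `hfield : IsField ↥(cartanAlgebra γ)` — §1′ below is that letter from `Irreducible χ_γ`, and §2 moves it along the torus `Z(γ)` to every regular `t ∈ Z(γ)`.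
THEOREMS ONLY (no `def`, no `instance`, no notation, no named-fact hypothesis, no `sorry`; default heartbeats); ★-only imports; NO `Lines` import; lane
`--supports stmt-HodgeConjecture-24833 --as helper`.

THE MATHEMATICS.
* §1 (matrix level, ANY field `K`, any `n`; no `CharZero`, no separability).  If `γ ∈ M_n(K)` has IRREDUCIBLE characteristic polynomial `χ` then (i) `n ≥ 1`; (ii) the
  minimal polynomial is `χ` (it divides `χ` and is not a unit) — `γ` is NON-DEROGATORY; (iii) hence the commutant `Z(γ)` is `K[γ] = {p(γ)}` (Horn–Johnson Thm. 3.2.4.2, ★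
  `exists_eq_aeval_of_commute_of_minpoly_eq_charpoly`); (iv) `K[γ] ≅ K[X]∕(χ)` is a FIELD — written Bézout-style inside `M_n(K)`: for `a = p(γ) ≠ 0` one has `χ ∤ p`
  (else `a = χ(γ)·r(γ) = 0` by Cayley–Hamilton), so `s·χ + t·p = 1` for some `s, t` (`χ` irreducible) and `t(γ)·p(γ) = 1` with `t(γ) ∈ K[γ] ⊆ Z(γ)`; commutativity
  of `Z(γ)` is `p(γ)q(γ) = q(γ)p(γ)`.  This is **`isField_cartanAlgebra_of_irreducible_charpoly`**.
* §1′ (`Gqs` level).  At a NON-SPLIT `v` the local ring `L ⊗ L⁺_v = L_w` is a field (★ `LocalRing.isField_of_smul_eq`), so §1 reads verbatim on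
  `γ ∈ Gqs L v = U(Φ₃)(L⁺_v)`: **`isField_cartanAlgebra_of_irreducible_charpoly_gqs`** — the `hfield` letter of the type-(3) dictionary.  Bonus: in characteristic `0` an
  irreducible `χ_γ` is separable, so such a `γ` is REGULAR (`isRegularElt_of_irreducible_charpoly_gqs`) and the dictionary docks on `Irreducible χ_γ` alone
  (`isConj_of_isStablyConjGAt_of_irreducible_charpoly`).
* §2 (closure along the torus).  For `γ` regular (separable `χ_γ`) the commutant `Z(γ)` is COMMUTATIVE (★ `commute_of_commute_of_isRegularElt_local`); if `t ∈ Z(γ)` is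
  itself regular then `Z(t) = Z(γ)` — `Z(γ) ⊆ Z(t)` because everything in `Z(γ)` commutes with `t ∈ Z(γ)`, and symmetrically with the roles of `γ ∈ Z(t)` and `t` exchanged:
  **`cartanAlgebra_eq_of_mem_cartanAlgebra_of_isRegularElt`**; in particular `Z(t)` is a field when `Z(γ)` is: **`isField_cartanAlgebra_of_mem_centralizer_of_isRegularElt`**
  (print: `T = Z_G(γ)` is a maximal torus and `Z_G(t) = T` for every regular `t ∈ T`, [§3.1 p. 19]).

HONEST LABEL: HC_CM is proved only modulo the 7 printed citations (2 remaining named inputs: hLiu418 = `stmt-HodgeConjecture-24832`, h413 = `stmt-HodgeConjecture-24833`) until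
rung 0 closes; CARD F is an input of the type-(3) row of the (DICT-Σ) assembly behind (DICT+COUNT-T) behind the OPEN (W-NP) socket — a ★ helper closes no socket; REL ≠ ★ ≠
BUILT; count-neutral.

## References
* [Rogawski1990] J. D. Rogawski, *Automorphic Representations of Unitary Groups in Three Variables*, Ann. of Math. Stud. 123 (1990), §3.1 p. 19 (regular elements, `G_γ = T`),
  §3.5 Prop. 3.5.2 p. 29, §3.6 pp. 28–31 (type (3): `L′ = K₃E` a field, `T ≅ K₃¹`, `|𝔇(T∕F)| = 1`), §12.5 p. 182.
* [HornJohnson2013] R. A. Horn, C. R. Johnson, *Matrix Analysis*, 2nd ed. (CUP 2013), §3.2.4 Thm. 3.2.4.2 p. 236 (commutant of a non-derogatory matrix), Thm. 3.3.15 p. 257.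
-/

set_option autoImplicit false
-- the mandated namespace repeats the single-problem summit's segment (`HodgeConjecture.HodgeConjecture`)
set_option linter.dupNamespace false

open Matrix Polynomial
open NumberField IsDedekindDomain
open scoped MatrixGroups
open Literature.NumberTheory.Rogawski1990 Literature.NumberTheory.Automorphic Literature.NumberTheory.Automorphic.UnitaryGroup
open Literature.LinearAlgebra.Matrix (exists_eq_aeval_of_commute_of_minpoly_eq_charpoly)
open Summit.HodgeConjecture.HodgeConjecture.Cruxes.H413

namespace Summit.HodgeConjecture.HodgeConjecture.R90.S4

/-! ## §1 Matrix level: an irreducible characteristic polynomial makes the Cartan algebra a field -/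

section MatrixLevel

variable {K : Type*} [Field K] {n : ℕ} {γ : Matrix (Fin n) (Fin n) K}

/-- A matrix with IRREDUCIBLE characteristic polynomial has positive size (`χ` of the empty matrix is the unit `1`). [folklore] -/
theorem pos_of_irreducible_charpoly (hirr : Irreducible γ.charpoly) : 0 < n := by
  have h := Polynomial.natDegree_pos_iff_degree_pos.2 (Polynomial.degree_pos_of_irreducible hirr)
  rwa [Matrix.charpoly_natDegree_eq_dim, Fintype.card_fin] at h

/-- **A matrix with IRREDUCIBLE characteristic polynomial is non-derogatory**: `minpoly K γ = χ_γ` (Mathlib `minpoly.eq_of_irreducible_of_monic` with Cayley–Hamilton;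
the size hypothesis is READ OFF `hirr`).  Twin of ★ `K2E3GL3ModUniformizerCentralizerCompact.minpoly_eq_charpoly_of_irreducible` (stated there under `[NeZero m]`; private
here to keep this file's imports ★-light). [cite: HornJohnson2013, Thm. 3.3.15 p. 257] -/
private theorem minpoly_eq_charpoly_of_irreducible_charpoly (hirr : Irreducible γ.charpoly) : minpoly K γ = γ.charpoly :=
  haveI : Nonempty (Fin n) := ⟨⟨0, pos_of_irreducible_charpoly hirr⟩⟩
  (minpoly.eq_of_irreducible_of_monic hirr (Matrix.aeval_self_charpoly γ) (Matrix.charpoly_monic γ)).symm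

/-- **The commutant of a matrix with irreducible characteristic polynomial is `K[γ]`**: every `x` commuting with `γ` is a polynomial in `γ` (Horn–Johnson Thm. 3.2.4.2
for the non-derogatory `γ`, ★ `exists_eq_aeval_of_commute_of_minpoly_eq_charpoly`). [cite: HornJohnson2013, §3.2.4 Thm. 3.2.4.2 p. 236] -/
theorem exists_eq_aeval_of_mem_cartanAlgebra_of_irreducible_charpoly (hirr : Irreducible γ.charpoly) {x : Matrix (Fin n) (Fin n) K}
    (hx : x ∈ cartanAlgebra γ) : ∃ p : K[X], x = aeval γ p := by
  obtain ⟨p, -, hp⟩ := exists_eq_aeval_of_commute_of_minpoly_eq_charpoly γ x (minpoly_eq_charpoly_of_irreducible_charpoly hirr)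
    (mem_cartanAlgebra_iff.1 hx).symm
  exact ⟨p, hp⟩

/-- `K[γ] ⊆ Z(γ)`: every polynomial in `γ` commutes with `γ`. [cite: Rogawski1990, §3.5 p. 29] -/
theorem aeval_mem_cartanAlgebra (γ : Matrix (Fin n) (Fin n) K) (p : K[X]) : aeval γ p ∈ cartanAlgebra γ :=
  Algebra.adjoin_le (Set.singleton_subset_iff.2 (self_mem_cartanAlgebra γ)) (Polynomial.aeval_mem_adjoin_singleton K γ)

/-- **CARD F §1 — THE CARTAN ALGEBRA OF A MATRIX WITH IRREDUCIBLE CHARACTERISTIC POLYNOMIAL IS A FIELD** (any field `K`, any size): `Z(γ) = K[γ] ≅ K[X]∕(χ_γ)`.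
Bézout inside `M_n(K)`: for `a = p(γ) ≠ 0`, `χ_γ ∤ p` (Cayley–Hamilton), so `s·χ_γ + t·p = 1` and `t(γ)` inverts `a` in `K[γ] ⊆ Z(γ)`; `Z(γ) = K[γ]` is commutative.  This is
type (3) of [§3.6]: `L′ = E_w[γ]` is a (cubic) FIELD. [cite: Rogawski1990, §3.6 p. 31; §3.5 p. 29] [cite: HornJohnson2013, §3.2.4 Thm. 3.2.4.2 p. 236] -/
theorem isField_cartanAlgebra_of_irreducible_charpoly (hirr : Irreducible γ.charpoly) : IsField ↥(cartanAlgebra γ) := by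
  classical
  haveI : Nonempty (Fin n) := ⟨⟨0, pos_of_irreducible_charpoly hirr⟩⟩
  refine ⟨⟨0, 1, fun h => zero_ne_one (congrArg Subtype.val h)⟩, fun x y => ?_, fun {a} ha => ?_⟩
  · -- `Z(γ) = K[γ]` is commutative
    obtain ⟨p, hp⟩ := exists_eq_aeval_of_mem_cartanAlgebra_of_irreducible_charpoly hirr x.2
    obtain ⟨q, hq⟩ := exists_eq_aeval_of_mem_cartanAlgebra_of_irreducible_charpoly hirr y.2
    apply Subtype.ext
    show x.1 * y.1 = y.1 * x.1
    rw [hp, hq, ← map_mul, ← map_mul, mul_comm]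
  · -- inverses by Bézout against the irreducible `χ_γ`
    obtain ⟨p, hp⟩ := exists_eq_aeval_of_mem_cartanAlgebra_of_irreducible_charpoly hirr a.2
    have hndvd : ¬ γ.charpoly ∣ p := by
      rintro ⟨r, hr⟩
      apply ha
      apply Subtype.ext
      show a.1 = 0
      rw [hp, hr, map_mul, Matrix.aeval_self_charpoly, zero_mul]
    obtain ⟨s, t, hst⟩ := hirr.coprime_iff_not_dvd.2 hndvd
    refine ⟨⟨aeval γ t, aeval_mem_cartanAlgebra γ t⟩, Subtype.ext ?_⟩
    show a.1 * aeval γ t = 1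
    have h := congrArg (aeval γ) hst
    rw [map_add, map_mul, map_mul, Matrix.aeval_self_charpoly, mul_zero, zero_add, map_one, ← map_mul] at h
    rw [hp, ← map_mul, mul_comm]
    exact h

end MatrixLevel

/-! ## §1′ and §2 On `Gqs L v = U(Φ₃)(L⁺_v)` at a non-split place -/

section GqsLevel

variable (L : Type) [Field L] [NumberField L] [IsCMField L] (v : HeightOneSpectrum (𝓞 ↥(maximalRealSubfield L)))

variable {L v}

/-- **CARD F §1′ — THE `hfield` LETTER OF THE TYPE-(3) DICTIONARY**: at a NON-SPLIT `v` (`L ⊗ L⁺_v = L_w` a field, ★ `LocalRing.isField_of_smul_eq`), an element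
`γ ∈ Gqs L v = U(Φ₃)(L⁺_v)` whose characteristic polynomial is IRREDUCIBLE (a cubic field `L_w[γ]`) has a FIELD as Cartan algebra `Z(γ) ⊆ M₃(L ⊗ L⁺_v)` — §1 read over the
field `L_w`.  Conclusion = the `hfield` binder of ★ `isConj_of_isStablyConjGAt_of_isField_cartanAlgebra`, byte for byte. [cite: Rogawski1990, §3.6 p. 31; §3.1 p. 19] -/
theorem isField_cartanAlgebra_of_irreducible_charpoly_gqs (hns : ∀ w : PlacesOver L v, IsCMField.complexConj L • w.1 = w.1) {γ : Gqs L v}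
    (hirr : Irreducible (γ.val.val : Matrix (Fin 3) (Fin 3) (LocalRing L v)).charpoly) :
    IsField ↥(cartanAlgebra (γ.val.val : Matrix (Fin 3) (Fin 3) (LocalRing L v))) := by
  obtain ⟨w⟩ := (inferInstance : Nonempty (PlacesOver L v))
  letI : Field (LocalRing L v) := (LocalRing.isField_of_smul_eq (IsCMField.complexConj L) (IsCMField.complexConj_ne_one L) w (hns w)).toField
  exact isField_cartanAlgebra_of_irreducible_charpoly hirr

/-- **An irreducible characteristic polynomial is REGULAR** (`Gqs` level, non-split `v`): `L_w` has characteristic `0`, so an irreducible `χ_γ` is separable, i.e. `γ` is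
regular semisimple (★ `IsRegularElt` := `χ_γ` separable) — the `Gqs L v` reading of ★ `F0P3cStCharTSTypeThreeTorus.isRegularElt_of_irreducible_charpoly_of_charZero`
(field level; here the field structure and `CharZero` of `L ⊗ L⁺_v` are supplied).  Lets the type-(3) row dock on `Irreducible χ_γ` alone. [cite: Rogawski1990, §3.1 p. 19; §3.6 p. 31] -/
theorem isRegularElt_of_irreducible_charpoly_gqs (hns : ∀ w : PlacesOver L v, IsCMField.complexConj L • w.1 = w.1) {γ : Gqs L v}
    (hirr : Irreducible (γ.val.val : Matrix (Fin 3) (Fin 3) (LocalRing L v)).charpoly) :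
    IsRegularElt (γ.val : GL (Fin 3) (LocalRing L v)) := by
  obtain ⟨w⟩ := (inferInstance : Nonempty (PlacesOver L v))
  letI : Field (LocalRing L v) := (LocalRing.isField_of_smul_eq (IsCMField.complexConj L) (IsCMField.complexConj_ne_one L) w (hns w)).toField
  haveI : CharZero (LocalRing L v) := charZero_of_injective_algebraMap (algebraMap L (LocalRing L v)).injective
  exact hirr.separable

/-- **Type (3) docks on the characteristic polynomial**: at a non-split `v`, if `χ_γ` is IRREDUCIBLE then every `γ′ ∈ Gqs L v` stably conjugate to `γ` is conjugate to `γ`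
in `Gqs L v` — ★ `isConj_of_isStablyConjGAt_of_isField_cartanAlgebra` with `hreg`, `hfield` both discharged from `Irreducible χ_γ` (`|𝔇(T∕F)| = 1` for the cubic tori).
[cite: Rogawski1990, §3.6 p. 31; §12.5 p. 182] -/
theorem isConj_of_isStablyConjGAt_of_irreducible_charpoly (hns : ∀ w : PlacesOver L v, IsCMField.complexConj L • w.1 = w.1) {γ γ' : Gqs L v}
    (hirr : Irreducible (γ.val.val : Matrix (Fin 3) (Fin 3) (LocalRing L v)).charpoly) (h : IsStablyConjGAt L (splitFormGL L) v γ γ') : IsConj γ γ' :=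
  isConj_of_isStablyConjGAt_of_isField_cartanAlgebra hns (isRegularElt_of_irreducible_charpoly_gqs hns hirr)
    (isField_cartanAlgebra_of_irreducible_charpoly_gqs hns hirr) h

/-- **CARD F §2 — THE CARTAN ALGEBRA IS CONSTANT ALONG THE TORUS**: for `γ ∈ Gqs L v` REGULAR and `t ∈ Z(γ)` REGULAR, `Z(t) = Z(γ)` as subalgebras of `M₃(L ⊗ L⁺_v)`.
Both commutants are commutative (★ `commute_of_commute_of_isRegularElt_local`, valid over the product of fields `L ⊗ L⁺_v` at any place): `x ∈ Z(γ)` commutes with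
`t ∈ Z(γ)`, so `Z(γ) ⊆ Z(t)`; and `γ ∈ Z(t)`, so `Z(t) ⊆ Z(γ)` likewise.  Print: `T = Z_G(γ)` is a maximal torus and `Z_G(t) = T` for every regular `t ∈ T`.
[cite: Rogawski1990, §3.1 p. 19; §3.5 p. 29] -/
theorem cartanAlgebra_eq_of_mem_cartanAlgebra_of_isRegularElt {γ t : Gqs L v} (hγ : IsRegularElt (γ.val : GL (Fin 3) (LocalRing L v)))
    (ht : (t.val.val : Matrix (Fin 3) (Fin 3) (LocalRing L v)) ∈ cartanAlgebra (γ.val.val : Matrix (Fin 3) (Fin 3) (LocalRing L v)))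
    (htreg : IsRegularElt (t.val : GL (Fin 3) (LocalRing L v))) :
    cartanAlgebra (t.val.val : Matrix (Fin 3) (Fin 3) (LocalRing L v)) = cartanAlgebra (γ.val.val : Matrix (Fin 3) (Fin 3) (LocalRing L v)) := by
  have htγ : Commute (t.val.val : Matrix (Fin 3) (Fin 3) (LocalRing L v)) (γ.val.val : Matrix (Fin 3) (Fin 3) (LocalRing L v)) :=
    mem_cartanAlgebra_iff.1 ht
  refine le_antisymm (fun x hx => ?_) (fun x hx => ?_)
  · -- `Z(t) ⊆ Z(γ)`: `x` and `γ` both commute with the regular `t`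
    rw [mem_cartanAlgebra_iff] at hx ⊢
    exact commute_of_commute_of_isRegularElt_local L v t htreg x _ hx htγ.symm
  · -- `Z(γ) ⊆ Z(t)`: `x` and `t` both commute with the regular `γ`
    rw [mem_cartanAlgebra_iff] at hx ⊢
    exact commute_of_commute_of_isRegularElt_local L v γ hγ x _ hx htγ

/-- **CARD F §2, corollary — the field property moves along the torus**: for `γ ∈ Gqs L v` regular with FIELD Cartan algebra and `t ∈ Z_{G_v}(γ)` regular, the Cartan
algebra of `t` is a field too (`Z(t) = Z(γ)`).  The type-(3) row of the (DICT-Σ) assembly eats this at every regular `t_k` of the member torus `T = Z(γ₀)`.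
[cite: Rogawski1990, §3.1 p. 19; §3.6 p. 31] -/
theorem isField_cartanAlgebra_of_mem_centralizer_of_isRegularElt {γ t : Gqs L v} (hγ : IsRegularElt (γ.val : GL (Fin 3) (LocalRing L v)))
    (hfield : IsField ↥(cartanAlgebra (γ.val.val : Matrix (Fin 3) (Fin 3) (LocalRing L v))))
    (ht : t ∈ Subgroup.centralizer ({γ} : Set (Gqs L v))) (htreg : IsRegularElt (t.val : GL (Fin 3) (LocalRing L v))) :
    IsField ↥(cartanAlgebra (t.val.val : Matrix (Fin 3) (Fin 3) (LocalRing L v))) := by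
  have ht' : (t.val.val : Matrix (Fin 3) (Fin 3) (LocalRing L v)) ∈ cartanAlgebra (γ.val.val : Matrix (Fin 3) (Fin 3) (LocalRing L v)) :=
    mem_cartanAlgebra_iff.2 (congrArg (fun g : Gqs L v => (g.val.val : Matrix (Fin 3) (Fin 3) (LocalRing L v))) (Subgroup.mem_centralizer_singleton_iff.1 ht))
  rw [cartanAlgebra_eq_of_mem_cartanAlgebra_of_isRegularElt hγ ht' htreg]
  exact hfield

-- NOT restated here: the centraliser-SUBGROUP form `Z_{G_v}(t) = Z_{G_v}(γ)` of §2 is already ★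
-- `Cruxes.H413.F0P3cStCharTSWeylCartanRadial.centralizer_eq_of_mem_centralizer_of_isRegularElt` (cite it; `Theorems/F0P3cStCharTSWeylCartanRadial.lean` :98).

end GqsLevel

end Summit.HodgeConjecture.HodgeConjecture.R90.S4
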